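import Literature.AlgebraicTopology.Homotopy.CollarDouble
import Mathlib.AlgebraicTopology.FundamentalGroupoid.FundamentalGroup
import HarnessLib

/-!
# Gluing a space to a collared space along the bottom of the collar: Mayer–Vietoris and van Kampen

Topic `Literature/AlgebraicTopology/Homotopy`, companion of `CollarDouble.lean` (the double
`W ∪_{∂W} W` of ONE collared space). Elementary homotopy theory of a space `P` which is the union
of two closed embedded pieces `j₁(W₁)`, `j₂(W₂)`, where `W₂` carries a boundary collar
`κ : A × [0, 1] → W₂` (`Literature.AlgebraicTopology.Homotopy.BoundaryCollar`, `CollarPush.lean`)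
and `W₁` a map `i₁ : A → W₁` ("the boundary of `W₁`"), the two pieces meeting exactly along
`i₁(A) ≡ κ(A × {0})`: `j₁ a = j₂ b ↔ ∃ z, a = i₁ z ∧ b = κ (z, 0)`. This is the topology of
`W ∪_∂ X` — a compact manifold `W` with a cobordism `X` attached along `∂W` (Milnor, *Lectures on
the h-cobordism theorem* (1965), Thm. 1.4; the tree's
`Literature.Topology.FourManifolds.CobordismAttachment`) — recorded as the structure
`Literature.AlgebraicTopology.Homotopy.BoundaryCollar.GluingData`; requested by the provefact unit
of `Literature.Barriers.SmoothPoincare4.akbulutRuberman2016_symmetryKillingCobordism`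
(Akbulut–Ruberman 2016, §3: "Since `V` and `V′` are simply connected homology balls, they are
contractible", for `V = W ∪_M X`).

Everything here is proved; there are no named facts.

* `GluingData.U t = P ∖ j₂ (core t)` and `GluingData.V = P ∖ j₁ (W₁) = j₂ (interior)` form an
  open cover of `P` with `U t ∩ V = j₂ (strip t)` (`U_union_V`, `U_inter_V`, `V_eq`), exactly as
  in `CollarDouble.lean`.
* **The squeeze** (`GluingData.squeeze`) of the collar of the second piece retracts `U t` onto
  `j₁ (W₁)`, so `W₁ ≅ j₁ (W₁) ↪ U t` is a homotopy equivalence (`homotopyEquivU`);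
  `V ≅ interior ≃ W₂` (`homotopyEquivV`) and `U t ∩ V ≅ strip t ≃ A`.
* **Homology** (`GluingData.isZero_singularHomology`): if `W₁` is contractible and the boundary
  inclusion `a ↦ κ (a, 0) : A → W₂` induces isomorphisms on `Hₖ(-; M)` for all `k`, then
  `Hₖ(P; M) = 0` for all `k ≥ 1` (Mayer–Vietoris, Hatcher, *Algebraic Topology* (2002), §2.2,
  p. 149: `Hₖ(U ∩ V) → Hₖ(V)` is then an isomorphism, `isIso_singularHomology_map_inter_V`).
* **Fundamental group** (`GluingData.simplyConnectedSpace`): if `W₁` is contractible, `W₂` and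
  `A` are path connected and every loop of `W₂` at a point `κ (a, 0)` is homotopic to the image
  of a loop of `A` ("`π₁(A) → π₁(W₂)` is onto"), then `P` is simply connected (van Kampen;
  Hatcher 2002, Lemma 1.15 in the form `Path.Homotopic.refl_of_isOpen_cover_of_null` proved
  here: the pieces of the open cover need not be simply connected, only their loops at the base
  point null-homotopic in the whole space).

## References

* A. Hatcher, *Algebraic Topology*, CUP (2002), Lemma 1.15, §1.2 (van Kampen), §2.2
  (Mayer–Vietoris, p. 149), Prop. 3.42 (collars). [HatcherAT2002]
* J. Milnor, *Lectures on the h-cobordism theorem*, Princeton (1965), §1, Thm. 1.4.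
  [MilnorHCobordism1965]
* S. Akbulut, D. Ruberman, *Absolutely exotic compact 4-manifolds*, Comment. Math. Helv. 91
  (2016) 1–19, §3. [AkbulutRuberman2016]
-/

noncomputable section

open Set Function Topology CategoryTheory CategoryTheory.Limits
open scoped unitInterval Topology ContinuousMap

universe u v

namespace Literature.AlgebraicTopology.Homotopy

/-! ### Hatcher's Lemma 1.15 with loops of the pieces null-homotopic in the whole space -/

section Cover

variable {X : Type*} [TopologicalSpace X]

open Path.Homotopic.Quotient in
/-- **Hatcher 2002, Lemma 1.15 (factorisation of loops along an open cover), null-homotopy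
form.** If `X` is covered by open sets `c i` all containing `x₀`, with pairwise path-connected
intersections, and every loop at `x₀` lying in a single `c i` is null-homotopic IN `X`, then
every loop at `x₀` is null-homotopic. (Lemma 1.15: every loop at `x₀` is homotopic to a product
of loops each contained in a single `c i` — the surjectivity half of van Kampen's theorem; the
tree's `Path.Homotopic.refl_of_isOpen_cover` is the special case of simply connected pieces, and
the proof is the same Lebesgue-number induction.) [cite: HatcherAT2002, Lemma 1.15] -/
theorem _root_.Path.Homotopic.refl_of_isOpen_cover_of_null {ι : Type*} {c : ι → Set X}
    (hco : ∀ i, IsOpen (c i)) (hcov : ⋃ i, c i = univ)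
    (hpc : ∀ i j, IsPathConnected (c i ∩ c j)) {x₀ : X} (hx₀ : ∀ i, x₀ ∈ c i)
    (hnull : ∀ i (p : Path x₀ x₀), (∀ s, p s ∈ c i) → p.Homotopic (Path.refl x₀))
    (γ : Path x₀ x₀) : γ.Homotopic (Path.refl x₀) := by
  classical
  have hnull' : ∀ i (p : Path x₀ x₀), (∀ s, p s ∈ c i) →
      mk p = Path.Homotopic.Quotient.refl x₀ := by
    intro i p hp
    rw [← mk_refl]
    exact Path.Homotopic.Quotient.eq.mpr (hnull i p hp)
  -- Lebesgue partition of `I` subordinate to `γ ⁻¹' c i`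
  have hc₁ : ∀ i, IsOpen (γ ⁻¹' c i) := fun i => (hco i).preimage γ.continuous
  have hc₂ : (univ : Set I) ⊆ ⋃ i, γ ⁻¹' c i := by
    intro s _
    have : γ s ∈ ⋃ i, c i := hcov ▸ mem_univ _
    simpa only [mem_iUnion, mem_preimage] using this
  obtain ⟨t, ht0, htmono, ⟨m, hm⟩, hsub⟩ :=
    exists_monotone_Icc_subset_open_cover_unitInterval hc₁ hc₂
  choose idx hidx using hsub
  have hγmem : ∀ k, ∀ s ∈ Icc (t k) (t (k + 1)), γ s ∈ c (idx k) := fun k s hs => hidx k hs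
  -- the pieces `P k = γ|[0, t k]` re-based at `x₀`
  set P : ∀ k, Path x₀ (γ (t k)) := fun k => (γ.subpath 0 (t k)).cast γ.source.symm rfl with hP
  -- the inductive claim
  have claim : ∀ k, ∃ g : Path x₀ (γ (t k)), (∀ s, g s ∈ c (idx k)) ∧
      (mk (P k)).trans (mk g).symm = Path.Homotopic.Quotient.refl x₀ := by
    have h0I : ∀ u : I, (0 : I) ≤ u := fun u => u.2.1
    have ht0u : ∀ u : I, t 0 ≤ u := fun u => by rw [ht0]; exact h0I u
    intro k
    induction k with
    | zero =>
      refine ⟨P 0, fun s => ?_, by simp⟩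
      have hs : (P 0) s ∈ range (γ.subpath 0 (t 0)) := ⟨s, rfl⟩
      rw [Path.range_subpath_of_le γ 0 (t 0) (h0I _)] at hs
      obtain ⟨u, hu, hus⟩ := hs
      rw [← hus]
      exact hγmem 0 u ⟨ht0u u, hu.2.trans (htmono (Nat.le_succ 0))⟩
    | succ k ih =>
      obtain ⟨g, hg, hS⟩ := ih
      have hy₁ : γ (t (k + 1)) ∈ c (idx k) := hγmem k _ ⟨htmono (Nat.le_succ k), le_rfl⟩
      have hy₂ : γ (t (k + 1)) ∈ c (idx (k + 1)) :=
        hγmem (k + 1) _ ⟨le_rfl, htmono (Nat.le_succ (k + 1))⟩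
      have hJ : JoinedIn (c (idx k) ∩ c (idx (k + 1))) x₀ (γ (t (k + 1))) :=
        (hpc _ _).joinedIn x₀ ⟨hx₀ _, hx₀ _⟩ _ ⟨hy₁, hy₂⟩
      set g' : Path x₀ (γ (t (k + 1))) := hJ.somePath with hg'
      have hg'mem : ∀ s, g' s ∈ c (idx k) ∩ c (idx (k + 1)) := hJ.somePath_mem
      set q : Path (γ (t k)) (γ (t (k + 1))) := γ.subpath (t k) (t (k + 1)) with hq
      have hqmem : ∀ s, q s ∈ c (idx k) := by
        intro s
        have hs : q s ∈ range q := ⟨s, rfl⟩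
        rw [hq, Path.range_subpath_of_le _ _ _ (htmono (Nat.le_succ k))] at hs
        obtain ⟨u, hu, hus⟩ := hs
        exact hus ▸ hγmem k u hu
      -- the loop `g · q · g'⁻¹` lies in `c (idx k)`, hence is trivial in `X`
      have hloop : mk ((g.trans q).trans g'.symm) = Path.Homotopic.Quotient.refl x₀ := by
        refine hnull' (idx k) _ fun s => ?_
        have hs : ((g.trans q).trans g'.symm) s ∈ range ((g.trans q).trans g'.symm) := ⟨s, rfl⟩
        rw [Path.trans_range, Path.trans_range, Path.symm_range] at hs
        rcases hs with (⟨u, hu⟩ | ⟨u, hu⟩) | ⟨u, hu⟩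
        exacts [hu ▸ hg u, hu ▸ hqmem u, hu ▸ (hg'mem u).1]
      have hPsucc : mk (P (k + 1)) = (mk (P k)).trans (mk q) := by
        have h1 : ((γ.subpath 0 (t k)).trans q).Homotopic (γ.subpath 0 (t (k + 1))) :=
          ⟨Path.Homotopy.subpathTransSubpath γ 0 (t k) (t (k + 1))⟩
        have h2 := h1.pathCast γ.source.symm rfl
        rw [Path.cast_trans _ _ γ.source.symm rfl rfl, Path.cast_rfl_rfl] at h2
        rw [← mk_trans]
        exact (Path.Homotopic.Quotient.eq.mpr h2).symm
      refine ⟨g', fun s => (hg'mem s).2, ?_⟩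
      simp only [mk_trans, mk_symm] at hloop
      calc (mk (P (k + 1))).trans (mk g').symm
          = (((mk (P k)).trans (mk g).symm).trans
              (((mk g).trans (mk q)).trans (mk g').symm)) := by
            rw [hPsucc]
            simp only [trans_assoc]
            rw [← Path.Homotopic.Quotient.trans_assoc (mk g).symm (mk g),
              Path.Homotopic.Quotient.symm_trans, Path.Homotopic.Quotient.refl_trans]
        _ = Path.Homotopic.Quotient.refl x₀ := by
            rw [hS, hloop, Path.Homotopic.Quotient.refl_trans]
  obtain ⟨g, hg, hS⟩ := claim m
  have hfin : ∀ (b : I) (g : Path x₀ (γ b)), (∀ s, g s ∈ c (idx m)) →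
      (mk ((γ.subpath 0 b).cast γ.source.symm rfl)).trans (mk g).symm =
        Path.Homotopic.Quotient.refl x₀ → b = 1 →
      γ.Homotopic (Path.refl x₀) := by
    intro b g hg hS hb
    subst hb
    have hgl0 : mk (g.cast rfl γ.target.symm) = Path.Homotopic.Quotient.refl x₀ :=
      hnull' (idx m) (g.cast rfl γ.target.symm) fun s => hg s
    have hQ : ((γ.subpath 0 1).cast γ.source.symm rfl).cast rfl γ.target.symm = γ := by
      ext s
      simp [Path.subpath]
    have key : (mk (((γ.subpath 0 1).cast γ.source.symm rfl).cast rfl γ.target.symm)).trans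
        (mk (g.cast rfl γ.target.symm)).symm =
        (mk ((γ.subpath 0 1).cast γ.source.symm rfl)).trans (mk g).symm := by
      have : ∀ {y' : X} (hy : y' = γ 1),
          (mk (((γ.subpath 0 1).cast γ.source.symm rfl).cast rfl hy)).trans
            (mk (g.cast rfl hy)).symm =
            (mk ((γ.subpath 0 1).cast γ.source.symm rfl)).trans (mk g).symm := by
        intro y' hy; subst hy; rfl
      exact this γ.target.symm
    rw [hS, hQ, hgl0, ← mk_refl, ← mk_symm, Path.refl_symm, mk_refl,
      Path.Homotopic.Quotient.trans_refl] at key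
    exact Path.Homotopic.Quotient.eq.mp key
  exact hfin (t m) g hg hS (hm m le_rfl)

/-- **Simple connectivity from an open cover whose loops are null-homotopic in the whole
space** (van Kampen, surjectivity half; Hatcher 2002, Lemma 1.15): if `X` is path connected and
covered by open sets `c i` all containing `x₀`, with pairwise path-connected intersections, and
every loop at `x₀` inside a single `c i` is null-homotopic in `X`, then `X` is simply connected.
[cite: HatcherAT2002, Lemma 1.15] -/
theorem simplyConnectedSpace_of_isOpen_cover_of_null [PathConnectedSpace X] {ι : Type*}
    {c : ι → Set X} (hco : ∀ i, IsOpen (c i)) (hcov : ⋃ i, c i = univ)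
    (hpc : ∀ i j, IsPathConnected (c i ∩ c j)) {x₀ : X} (hx₀ : ∀ i, x₀ ∈ c i)
    (hnull : ∀ i (p : Path x₀ x₀), (∀ s, p s ∈ c i) → p.Homotopic (Path.refl x₀)) :
    SimplyConnectedSpace X :=
  Literature.AlgebraicTopology.FundamentalGroup.simplyConnectedSpace_of_loops_nullhomotopic_at x₀
    (Path.Homotopic.refl_of_isOpen_cover_of_null hco hcov hpc hx₀ hnull)

end Cover

/-! ### Surjectivity on fundamental groups, unbundled -/

section PiOne

variable {A : Type u} [TopologicalSpace A] {W : Type v} [TopologicalSpace W]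

/-- If `f_* : π₁(A, a) → π₁(W, f a)` (Mathlib's `FundamentalGroup.map`) is surjective, every loop
of `W` at `f a` is homotopic to the image of a loop of `A` at `a`. [folklore] -/
theorem exists_homotopic_map_of_surjective_fundamentalGroupMap (f : C(A, W)) (a : A)
    (hf : Function.Surjective (FundamentalGroup.map f a)) (γ : Path (f a) (f a)) :
    ∃ ℓ : Path a a, γ.Homotopic (ℓ.map f.continuous) := by
  obtain ⟨g, hg⟩ := hf (FundamentalGroup.fromPath (Path.Homotopic.Quotient.mk γ))
  induction g using Quotient.inductionOn with
  | h ℓ =>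
    refine ⟨ℓ, ?_⟩
    have h1 : FundamentalGroup.map f a (FundamentalGroup.fromPath (Path.Homotopic.Quotient.mk ℓ)) =
        FundamentalGroup.fromPath (Path.Homotopic.Quotient.mk (ℓ.map f.continuous)) := rfl
    have h2 : (Path.Homotopic.Quotient.mk (ℓ.map f.continuous) : Path.Homotopic.Quotient _ _) =
        Path.Homotopic.Quotient.mk γ := h1.symm.trans hg
    exact (Path.Homotopic.Quotient.eq.mp h2).symm

end PiOne

namespace BoundaryCollar

variable {W₁ : Type u} [TopologicalSpace W₁] {W₂ : Type u} [TopologicalSpace W₂]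
  {A : Type u} [TopologicalSpace A]

/-- **Gluing data** for a collared space. For a boundary collar `κ : A × [0, 1] → W₂` and a map
`i₁ : A → W₁`, a space `P` *is the gluing of `W₁` and `W₂` along `i₁(A) ≡ κ(A × {0})`* if it
carries two closed embeddings `j₁ : W₁ → P`, `j₂ : W₂ → P` whose ranges cover `P` and which
identify exactly the points `i₁ z` and `κ (z, 0)`: `j₁ a = j₂ b ↔ ∃ z, a = i₁ z ∧ b = κ (z, 0)`.
For a compact smooth manifold with boundary `W₁ = W`, `A = ∂W`, `i₁` the inclusion, and a
cobordism `W₂ = X` from `∂W` collared at its incoming end, this is the topological content of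
`W ∪_{∂W} X` (Milnor 1965, Thm. 1.4; the tree's `Literature.Topology.FourManifolds.CobordismAttachment`);
for `W₁ = W₂`, `i₁ = κ(·, 0)` it is the double (`BoundaryCollar.DoubleData`).
[cite: MilnorHCobordism1965, §1, Thm. 1.4] -/
structure GluingData (κ : BoundaryCollar W₂ A) (i₁ : A → W₁) (P : Type u) [TopologicalSpace P]
    where
  /-- The first piece. -/
  j₁ : W₁ → P
  /-- The second (collared) piece. -/
  j₂ : W₂ → P
  /-- The first piece is a closed embedding. -/
  isClosedEmbedding_j₁ : IsClosedEmbedding j₁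
  /-- The second piece is a closed embedding. -/
  isClosedEmbedding_j₂ : IsClosedEmbedding j₂
  /-- The two pieces cover `P`. -/
  range_union_range : range j₁ ∪ range j₂ = univ
  /-- The two pieces meet exactly along `i₁(A) ≡ κ(A × {0})`, pointwise. -/
  j₁_eq_j₂_iff : ∀ a b, j₁ a = j₂ b ↔ ∃ z : A, a = i₁ z ∧ b = κ.collar (z, 0)

/-- A double (`BoundaryCollar.DoubleData`) is the gluing of the collared space with itself
along the bottom of the collar, `i₁ = κ(·, 0)`: `GluingData` generalises `DoubleData` to two
different pieces (the lemmas below on the cover `U t`, `V` and the squeeze are the two-piece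
versions of those of `CollarDouble.lean`). [folklore] -/
def _root_.Literature.AlgebraicTopology.Homotopy.BoundaryCollar.DoubleData.toGluingData
    {κ : BoundaryCollar W₂ A} {P : Type u} [TopologicalSpace P] (d : κ.DoubleData P) :
    κ.GluingData (fun a : A => κ.collar (a, 0)) P where
  j₁ := d.jA
  j₂ := d.jB
  isClosedEmbedding_j₁ := d.isClosedEmbedding_jA
  isClosedEmbedding_j₂ := d.isClosedEmbedding_jB
  range_union_range := d.range_union_range
  j₁_eq_j₂_iff := d.jA_eq_jB_iff

namespace GluingData

variable {κ : BoundaryCollar W₂ A} {i₁ : A → W₁} {P : Type u} [TopologicalSpace P]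
  (d : κ.GluingData i₁ P)

attribute [local instance] Classical.propDecidable

/-! ### The seam -/

/-- On the seam the two pieces agree: `j₁ (i₁ z) = j₂ (κ (z, 0))`. [folklore] -/
theorem j₁_seam (z : A) : d.j₁ (i₁ z) = d.j₂ (κ.collar (z, 0)) :=
  (d.j₁_eq_j₂_iff _ _).2 ⟨z, rfl, rfl⟩

/-- A point off the first piece lies on the second. [folklore] -/
theorem mem_range_j₂_of_not_mem_range_j₁ {p : P} (h : p ∉ range d.j₁) : p ∈ range d.j₂ := by
  have hp : p ∈ range d.j₁ ∪ range d.j₂ := by rw [d.range_union_range]; exact mem_univ p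
  exact hp.resolve_left h

/-- A point off the second piece lies on the first. [folklore] -/
theorem mem_range_j₁_of_not_mem_range_j₂ {p : P} (h : p ∉ range d.j₂) : p ∈ range d.j₁ := by
  have hp : p ∈ range d.j₁ ∪ range d.j₂ := by rw [d.range_union_range]; exact mem_univ p
  exact hp.resolve_right h

/-- A point of the second piece lies on the first piece iff it is a bottom point of the collar.
[folklore] -/
theorem j₂_mem_range_j₁_iff {b : W₂} :
    d.j₂ b ∈ range d.j₁ ↔ b ∈ range (fun z : A => κ.collar (z, 0)) := by
  constructor
  · rintro ⟨a, ha⟩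
    obtain ⟨z, -, rfl⟩ := (d.j₁_eq_j₂_iff a b).1 ha
    exact ⟨z, rfl⟩
  · rintro ⟨z, rfl⟩
    exact ⟨i₁ z, d.j₁_seam z⟩

/-- A point of the first piece lies on the second piece iff it is a point of `i₁(A)`.
[folklore] -/
theorem j₁_mem_range_j₂_iff {a : W₁} : d.j₁ a ∈ range d.j₂ ↔ a ∈ range i₁ := by
  constructor
  · rintro ⟨b, hb⟩
    obtain ⟨z, rfl, -⟩ := (d.j₁_eq_j₂_iff a b).1 hb.symm
    exact ⟨z, rfl⟩
  · rintro ⟨z, rfl⟩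
    exact ⟨κ.collar (z, 0), (d.j₁_seam z).symm⟩

include d in
/-- `P` is compact if both pieces are. [folklore] -/
theorem compactSpace [CompactSpace W₁] [CompactSpace W₂] : CompactSpace P := by
  refine ⟨?_⟩
  rw [← d.range_union_range]
  exact (isCompact_range d.isClosedEmbedding_j₁.continuous).union
    (isCompact_range d.isClosedEmbedding_j₂.continuous)

/-! ### The open cover `U t`, `V` -/

/-- `V = P ∖ j₁ (W₁)`, the open complement of the first piece. [folklore] -/
def V : Set P := (range d.j₁)ᶜ

/-- `V` is open. [folklore] -/
theorem isOpen_V : IsOpen d.V := d.isClosedEmbedding_j₁.isClosed_range.isOpen_compl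

/-- `V = j₂ (interior)`: the complement of the first piece is the second piece's interior.
[folklore] -/
theorem V_eq : d.V = d.j₂ '' κ.interior := by
  ext p
  constructor
  · intro hp
    obtain ⟨b, rfl⟩ := d.mem_range_j₂_of_not_mem_range_j₁ hp
    exact ⟨b, fun hb => hp (d.j₂_mem_range_j₁_iff.2 hb), rfl⟩
  · rintro ⟨b, hb, rfl⟩ hmem
    exact hb (d.j₂_mem_range_j₁_iff.1 hmem)

/-- `U t = P ∖ j₂ (core t)`: the first piece together with the second piece's open collar below
level `t`. [folklore] -/
def U (t : I) : Set P := (d.j₂ '' κ.core t)ᶜ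

/-- `U t` is open (the core is closed and `j₂` is a closed map). [folklore] -/
theorem isOpen_U (t : I) : IsOpen (d.U t) :=
  (d.isClosedEmbedding_j₂.isClosedMap _ (κ.isClosed_core t)).isOpen_compl

/-- A point of the second piece lies in `U t` iff it lies below level `t`. [folklore] -/
theorem j₂_mem_U_iff {b : W₂} {t : I} : d.j₂ b ∈ d.U t ↔ b ∈ κ.below t := by
  rw [U, mem_compl_iff, d.isClosedEmbedding_j₂.injective.mem_set_image, κ.mem_core_iff, not_not]

/-- For `t > 0` the first piece lies in `U t`. [folklore] -/
theorem range_j₁_subset_U {t : I} (ht : 0 < t) : range d.j₁ ⊆ d.U t := by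
  rintro _ ⟨a, rfl⟩ ⟨b, hb, hba⟩
  obtain ⟨z, rfl, rfl⟩ := (d.j₁_eq_j₂_iff a b).1 hba.symm
  exact not_lt.2 (κ.collar_mem_core_iff.1 hb) ht

/-- For `t > 0`, `U t` and `V` cover `P`. [folklore] -/
theorem U_union_V {t : I} (ht : 0 < t) : d.U t ∪ d.V = univ :=
  eq_univ_of_forall fun p => by
    by_cases hp : p ∈ range d.j₁
    · exact Or.inl (d.range_j₁_subset_U ht hp)
    · exact Or.inr hp

/-- For `t > 0` the interiors of `U t` and `V` cover `P` (both are open). [folklore] -/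
theorem interior_U_union_interior_V {t : I} (ht : 0 < t) :
    _root_.interior (d.U t) ∪ _root_.interior d.V = univ := by
  rw [(d.isOpen_U t).interior_eq, d.isOpen_V.interior_eq, d.U_union_V ht]

/-- `U t ∩ V = j₂ (strip t)`, the second piece's open strip between the bottom and level `t`.
[folklore] -/
theorem U_inter_V (t : I) : d.U t ∩ d.V = d.j₂ '' κ.strip t := by
  ext p
  constructor
  · rintro ⟨hU, hV⟩
    rw [V_eq] at hV
    obtain ⟨b, hb, rfl⟩ := hV
    refine ⟨b, ?_, rfl⟩
    rw [κ.strip_eq]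
    exact ⟨hb, d.j₂_mem_U_iff.1 hU⟩
  · rintro ⟨b, hb, rfl⟩
    rw [κ.strip_eq] at hb
    refine ⟨d.j₂_mem_U_iff.2 hb.2, ?_⟩
    rw [V_eq]
    exact ⟨b, hb.1, rfl⟩

/-! ### Homeomorphisms onto the pieces -/

/-- A subset of `W₂` is homeomorphic to its image in the second piece. [folklore] -/
def j₂ImageHomeomorph (s : Set W₂) : ↥s ≃ₜ ↥(d.j₂ '' s) :=
  (d.isClosedEmbedding_j₂.isEmbedding.comp IsEmbedding.subtypeVal).toHomeomorph.trans
    (Homeomorph.setCongr (by rw [range_comp, Subtype.range_coe]))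

/-- The homeomorphism onto the image is `j₂` on points. [folklore] -/
@[simp] theorem j₂ImageHomeomorph_apply_coe (s : Set W₂) (x : s) :
    (d.j₂ImageHomeomorph s x : P) = d.j₂ x := rfl

/-- `V ≅ interior`. [folklore] -/
def VHomeomorph : ↥κ.interior ≃ₜ ↥d.V :=
  (d.j₂ImageHomeomorph κ.interior).trans (Homeomorph.setCongr d.V_eq.symm)

/-- `VHomeomorph` is `j₂` on points. [folklore] -/
@[simp] theorem VHomeomorph_apply_coe (x : κ.interior) : (d.VHomeomorph x : P) = d.j₂ x := rfl

/-- `U t ∩ V ≅ strip t`. [folklore] -/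
def UInterVHomeomorph (t : I) : ↥(κ.strip t) ≃ₜ ↥(d.U t ∩ d.V) :=
  (d.j₂ImageHomeomorph (κ.strip t)).trans (Homeomorph.setCongr (d.U_inter_V t).symm)

/-- `UInterVHomeomorph` is `j₂` on points. [folklore] -/
@[simp] theorem UInterVHomeomorph_apply_coe (t : I) (x : κ.strip t) :
    (d.UInterVHomeomorph t x : P) = d.j₂ x := rfl

/-- `W₁ ≅ j₁ (W₁)`. [folklore] -/
def j₁Homeomorph : W₁ ≃ₜ ↥(range d.j₁) := d.isClosedEmbedding_j₁.isEmbedding.toHomeomorph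

variable [Nonempty A]

/-- **`V ≃ W₂`**: `V ≅ interior ≃ W₂` (`interiorHomotopyEquiv`, Hatcher 2002, Prop. 3.42).
[cite: HatcherAT2002, Prop. 3.42] -/
def homotopyEquivV {t : I} (ht : 0 < t) : ↥d.V ≃ₕ W₂ :=
  d.VHomeomorph.symm.toHomotopyEquiv.trans (κ.interiorHomotopyEquiv ht)

/-- `V` is path connected when `W₂` is. [folklore] -/
theorem isPathConnected_V [PathConnectedSpace W₂] {t : I} (ht : 0 < t) : IsPathConnected d.V := by
  haveI : PathConnectedSpace ↥d.V := pathConnectedSpace_of_homotopyEquiv (d.homotopyEquivV ht).symm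
  exact isPathConnected_iff_pathConnectedSpace.2 this

/-- `U t ∩ V` is path connected when `A` is (`U t ∩ V ≅ strip t ≃ A`). [folklore] -/
theorem isPathConnected_U_inter_V [PathConnectedSpace A] {t : I} (ht : 0 < t) :
    IsPathConnected (d.U t ∩ d.V) := by
  obtain ⟨u, hu, hut⟩ := DoubleData.exists_level_between ht
  haveI : PathConnectedSpace ↥(d.U t ∩ d.V) :=
    pathConnectedSpace_of_homotopyEquiv
      ((κ.stripHomotopyEquiv hu hut).trans (d.UInterVHomeomorph t).toHomotopyEquiv)
  exact isPathConnected_iff_pathConnectedSpace.2 this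

/-! ### The squeeze of the collar of the second piece -/

/-- A total inverse of `j₂` (junk off its range). [folklore] -/
def j₂Inv (p : P) : W₂ :=
  if h : p ∈ range d.j₂ then d.isClosedEmbedding_j₂.isEmbedding.toHomeomorph.symm ⟨p, h⟩
  else κ.collar (Classical.arbitrary A, 0)

/-- `j₂Inv ∘ j₂ = id`. [folklore] -/
@[simp] theorem j₂Inv_j₂ (b : W₂) : d.j₂Inv (d.j₂ b) = b := by
  rw [j₂Inv, dif_pos (mem_range_self b)]
  exact d.isClosedEmbedding_j₂.isEmbedding.toHomeomorph_symm_apply b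

/-- `j₂ ∘ j₂Inv = id` on the range of `j₂`. [folklore] -/
theorem j₂_j₂Inv {p : P} (hp : p ∈ range d.j₂) : d.j₂ (d.j₂Inv p) = p := by
  obtain ⟨b, rfl⟩ := hp
  rw [j₂Inv_j₂]

/-- `j₂Inv` is continuous on the range of `j₂`. [folklore] -/
theorem continuousOn_j₂Inv : ContinuousOn d.j₂Inv (range d.j₂) := by
  rw [continuousOn_iff_continuous_restrict]
  have h : (range d.j₂).restrict d.j₂Inv = d.isClosedEmbedding_j₂.isEmbedding.toHomeomorph.symm := by
    funext ⟨p, hp⟩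
    simp only [restrict_apply, j₂Inv, dif_pos hp]
  rw [h]
  exact Homeomorph.continuous _

/-- **The squeeze**: `j₂ (κ (a, r)) ↦ j₂ (κ (a, (1 - s) r))` on the second piece, the identity
off it (meaningful on `U t`, where the second piece is met only below level `t`); `scale` is
the squeezed level of `CollarDouble.lean`. [folklore] -/
def squeeze (s : I) (p : P) : P :=
  if p ∈ range d.j₂ then
    d.j₂ (κ.collar ((κ.inv (d.j₂Inv p)).1, DoubleData.scale s (κ.inv (d.j₂Inv p)).2))
  else p

/-- The squeeze on the collar of the second piece. [folklore] -/
@[simp] theorem squeeze_j₂_collar (s : I) (q : A × I) :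
    d.squeeze s (d.j₂ (κ.collar q)) = d.j₂ (κ.collar (q.1, DoubleData.scale s q.2)) := by
  rw [squeeze, if_pos (mem_range_self _), j₂Inv_j₂, κ.inv_collar]

/-- The squeeze off the second piece is the identity. [folklore] -/
theorem squeeze_of_not_mem (s : I) {p : P} (hp : p ∉ range d.j₂) : d.squeeze s p = p := if_neg hp

/-- The squeeze fixes the first piece (on the seam the level is `0`). [folklore] -/
theorem squeeze_of_mem_range_j₁ (s : I) {p : P} (hp : p ∈ range d.j₁) : d.squeeze s p = p := by
  by_cases hB : p ∈ range d.j₂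
  · obtain ⟨b, rfl⟩ := hB
    obtain ⟨z, rfl⟩ := d.j₂_mem_range_j₁_iff.1 hp
    rw [squeeze_j₂_collar, DoubleData.scale_zero_right]
  · exact d.squeeze_of_not_mem s hB

/-- At `s = 0` the squeeze is the identity on `U t`. [folklore] -/
theorem squeeze_zero {t : I} {p : P} (hp : p ∈ d.U t) : d.squeeze 0 p = p := by
  by_cases hB : p ∈ range d.j₂
  · obtain ⟨b, rfl⟩ := hB
    obtain ⟨q, -, rfl⟩ := d.j₂_mem_U_iff.1 hp
    rw [squeeze_j₂_collar, DoubleData.scale_zero_left]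
  · exact d.squeeze_of_not_mem 0 hB

/-- The squeeze preserves `U t`. [folklore] -/
theorem squeeze_mapsTo (s t : I) : MapsTo (d.squeeze s) (d.U t) (d.U t) := by
  intro p hp
  by_cases hB : p ∈ range d.j₂
  · obtain ⟨b, rfl⟩ := hB
    obtain ⟨q, hq, rfl⟩ := d.j₂_mem_U_iff.1 hp
    rw [squeeze_j₂_collar, j₂_mem_U_iff, collar_mem_below_iff]
    exact lt_of_le_of_lt (DoubleData.scale_le s q.2) hq
  · rw [d.squeeze_of_not_mem s hB]
    exact hp

/-- At `s = 1` the squeeze retracts `U t` onto the first piece. [folklore] -/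
theorem squeeze_one_mem {t : I} {p : P} (hp : p ∈ d.U t) : d.squeeze 1 p ∈ range d.j₁ := by
  by_cases hB : p ∈ range d.j₂
  · obtain ⟨b, rfl⟩ := hB
    obtain ⟨q, -, rfl⟩ := d.j₂_mem_U_iff.1 hp
    rw [squeeze_j₂_collar, DoubleData.scale_one_left]
    exact ⟨i₁ q.1, d.j₁_seam q.1⟩
  · rw [d.squeeze_of_not_mem 1 hB]
    exact d.mem_range_j₁_of_not_mem_range_j₂ hB

/-- **The squeeze is jointly continuous on `[0, 1] × U t`**: pasting along the closed cover of `P`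
by `range j₁` and `range j₂`, on whose intersection (the seam, level `0`) both formulas are the
identity; on `U t` the second piece is met inside the collar, where `κ⁻¹` is continuous.
[folklore] -/
theorem continuousOn_squeeze (t : I) :
    ContinuousOn (fun q : I × P => d.squeeze q.1 q.2) (univ ×ˢ d.U t) := by
  have hS : IsClosed {q : I × P | q.2 ∈ range d.j₂} :=
    d.isClosedEmbedding_j₂.isClosed_range.preimage continuous_snd
  have hT : IsClosed {q : I × P | q.2 ∈ range d.j₁} :=
    d.isClosedEmbedding_j₁.isClosed_range.preimage continuous_snd
  change ContinuousOn (fun q : I × P => if q.2 ∈ range d.j₂ then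
    d.j₂ (κ.collar ((κ.inv (d.j₂Inv q.2)).1, DoubleData.scale q.1 (κ.inv (d.j₂Inv q.2)).2))
    else q.2) _
  refine ContinuousOn.if ?_ ?_ ?_
  · rintro ⟨s, p⟩ ⟨-, hfr⟩
    have hpB : p ∈ range d.j₂ := by
      have h := frontier_subset_closure hfr
      rwa [hS.closure_eq] at h
    have hpA : p ∈ range d.j₁ := by
      have h1 : ((s, p) : I × P) ∈ closure {q : I × P | q.2 ∈ range d.j₂}ᶜ := by
        rw [frontier_eq_closure_inter_closure] at hfr
        exact hfr.2
      have hsub : {q : I × P | q.2 ∈ range d.j₂}ᶜ ⊆ {q : I × P | q.2 ∈ range d.j₁} :=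
        fun q hq => d.mem_range_j₁_of_not_mem_range_j₂ hq
      exact (hT.closure_subset_iff.2 hsub) h1
    obtain ⟨b, rfl⟩ := hpB
    obtain ⟨z, rfl⟩ := d.j₂_mem_range_j₁_iff.1 hpA
    show d.j₂ (κ.collar _) = d.j₂ (κ.collar (z, 0))
    rw [j₂Inv_j₂, κ.inv_collar, DoubleData.scale_zero_right]
  · rw [hS.closure_eq]
    have hmaps : MapsTo (fun q : I × P => d.j₂Inv q.2)
        ((univ ×ˢ d.U t) ∩ {q : I × P | q.2 ∈ range d.j₂}) (range κ.collar) := by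
      rintro ⟨s, p⟩ ⟨⟨-, hU⟩, hB⟩
      obtain ⟨b, hb⟩ := hB
      subst hb
      show d.j₂Inv (d.j₂ b) ∈ range κ.collar
      rw [j₂Inv_j₂]
      exact κ.below_subset_range t (d.j₂_mem_U_iff.1 hU)
    have h1 : ContinuousOn (fun q : I × P => d.j₂Inv q.2)
        ((univ ×ˢ d.U t) ∩ {q : I × P | q.2 ∈ range d.j₂}) :=
      d.continuousOn_j₂Inv.comp continuous_snd.continuousOn fun q hq => hq.2
    have h2 : ContinuousOn (fun q : I × P => κ.inv (d.j₂Inv q.2))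
        ((univ ×ˢ d.U t) ∩ {q : I × P | q.2 ∈ range d.j₂}) :=
      κ.continuousOn_inv.comp h1 hmaps
    have hF : Continuous fun r : I × (A × I) =>
        d.j₂ (κ.collar (r.2.1, DoubleData.scale r.1 r.2.2)) :=
      d.isClosedEmbedding_j₂.continuous.comp (κ.continuous.comp
        ((continuous_fst.comp continuous_snd).prodMk
          (DoubleData.continuous_scale.comp
            (continuous_fst.prodMk (continuous_snd.comp continuous_snd)))))
    exact hF.comp_continuousOn (continuous_fst.continuousOn.prodMk h2)
  · exact continuous_snd.continuousOn

/-- The squeeze as a jointly continuous self-map of `U t` over `[0, 1]`. [folklore] -/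
def squeezeMap (t : I) : C(I × ↥(d.U t), ↥(d.U t)) where
  toFun q := ⟨d.squeeze q.1 q.2, d.squeeze_mapsTo q.1 t q.2.2⟩
  continuous_toFun :=
    ((d.continuousOn_squeeze t).comp_continuous
      (continuous_fst.prodMk (continuous_subtype_val.comp continuous_snd))
      fun q => ⟨mem_univ _, q.2.2⟩).subtype_mk _

/-- The squeeze self-map on points. [folklore] -/
@[simp] theorem squeezeMap_apply_coe (t : I) (q : I × ↥(d.U t)) :
    (d.squeezeMap t q : P) = d.squeeze q.1 q.2 := rfl

/-- **The first piece is a deformation retract of `U t`** (`t > 0`): the inclusion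
`j₁ (W₁) ↪ U t` is a homotopy equivalence with inverse the full squeeze `squeeze 1`
(Hatcher 2002, Ch. 0, deformation retractions). [cite: HatcherAT2002, Ch. 0 (deformation retraction)] -/
def rangeHomotopyEquiv {t : I} (ht : 0 < t) : (↥(range d.j₁)) ≃ₕ ↥(d.U t) where
  toFun := ⟨Set.inclusion (d.range_j₁_subset_U ht), continuous_inclusion _⟩
  invFun := ⟨fun p => ⟨d.squeeze 1 p, d.squeeze_one_mem p.2⟩,
    (continuous_subtype_val.comp ((d.squeezeMap t).continuous.comp
      (Continuous.prodMk_right (1 : I)))).subtype_mk _⟩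
  left_inv := by
    have h : (⟨fun p => ⟨d.squeeze 1 p, d.squeeze_one_mem p.2⟩,
        (continuous_subtype_val.comp ((d.squeezeMap t).continuous.comp
          (Continuous.prodMk_right (1 : I)))).subtype_mk _⟩ : C(↥(d.U t), ↥(range d.j₁))).comp
        ⟨Set.inclusion (d.range_j₁_subset_U ht), continuous_inclusion _⟩ =
        ContinuousMap.id _ := by
      ext p
      exact d.squeeze_of_mem_range_j₁ 1 p.2
    rw [h]
  right_inv :=
    ⟨{ toFun := fun q => d.squeezeMap t (unitInterval.symm q.1, q.2)
       continuous_toFun := (d.squeezeMap t).continuous.comp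
         ((unitInterval.continuous_symm.comp continuous_fst).prodMk continuous_snd)
       map_zero_left := fun p => Subtype.ext (by simp)
       map_one_left := fun p => Subtype.ext (by simpa using d.squeeze_zero p.2) }⟩

/-- **`W₁ ≃ U t`** for `t > 0`: `W₁ ≅ j₁ (W₁) ↪ U t`. [cite: HatcherAT2002, Ch. 0 (deformation retraction)] -/
def homotopyEquivU {t : I} (ht : 0 < t) : W₁ ≃ₕ ↥(d.U t) :=
  d.j₁Homeomorph.toHomotopyEquiv.trans (d.rangeHomotopyEquiv ht)

/-- The forward map of `homotopyEquivU` is `j₁`. [folklore] -/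
@[simp] theorem homotopyEquivU_apply_coe {t : I} (ht : 0 < t) (w : W₁) :
    (d.homotopyEquivU ht w : P) = d.j₁ w := rfl

/-- **`U t` is contractible when `W₁` is** (`t > 0`). [folklore] -/
theorem contractibleSpace_U [ContractibleSpace W₁] {t : I} (ht : 0 < t) :
    ContractibleSpace ↥(d.U t) :=
  (d.homotopyEquivU ht).symm.contractibleSpace

include d in
/-- `P` is path connected if `W₁` and `W₂` are (for `t > 0` the path-connected open sets `U t`,
`V` cover `P` and meet, `A` being nonempty). [folklore] -/
theorem pathConnectedSpace [PathConnectedSpace W₁] [PathConnectedSpace W₂] :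
    PathConnectedSpace P := by
  obtain ⟨t, ht⟩ : ∃ t : I, 0 < t := ⟨1, zero_lt_one⟩
  have hU : IsPathConnected (d.U t) := by
    haveI : PathConnectedSpace ↥(d.U t) := pathConnectedSpace_of_homotopyEquiv (d.homotopyEquivU ht)
    exact isPathConnected_iff_pathConnectedSpace.2 this
  have hV : IsPathConnected d.V := d.isPathConnected_V ht
  obtain ⟨u, hu, hut⟩ := DoubleData.exists_level_between ht
  let a : A := Classical.arbitrary A
  have hx : d.j₂ (κ.collar (a, u)) ∈ d.U t ∩ d.V := by
    rw [d.U_inter_V t]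
    exact ⟨κ.collar (a, u), ⟨(a, u), ⟨hu, hut⟩, rfl⟩, rfl⟩
  rw [pathConnectedSpace_iff_univ, ← d.U_union_V ht]
  exact hU.union hV ⟨_, hx⟩

/-! ### Homology: `Hₖ(P) = 0` when `W₁` is contractible and `A → W₂` is a homology isomorphism -/

section Homology

open Literature.AlgebraicTopology.SingularHomology

variable (R : Type v) [CommRing R] (M : Type v) [AddCommGroup M] [Module R M]

omit [Nonempty A] in
/-- The boundary inclusion `a ↦ κ (a, 0)` of the collared piece, as a continuous map. [folklore] -/
def bottom (κ : BoundaryCollar W₂ A) : C(A, W₂) :=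
  ⟨fun a => κ.collar (a, 0), κ.continuous.comp (Continuous.prodMk_left 0)⟩

omit [Nonempty A] in
/-- `bottom κ a = κ (a, 0)`. [folklore] -/
@[simp] theorem bottom_apply (κ : BoundaryCollar W₂ A) (a : A) : bottom κ a = κ.collar (a, 0) := rfl

omit [Nonempty A] in
/-- The slice `a ↦ κ (a, u)` into the interior, for a positive level `u`. [folklore] -/
def sliceInterior (κ : BoundaryCollar W₂ A) {u : I} (hu : 0 < u) : C(A, ↥κ.interior) :=
  ⟨fun a => ⟨κ.collar (a, u), κ.collar_mem_interior_iff.2 hu⟩,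
    (κ.continuous.comp (Continuous.prodMk_left u)).subtype_mk _⟩

omit [Nonempty A] in
/-- The slice at level `u`, followed by the inclusion of the interior, is homotopic to the
boundary inclusion (slide down the collar). [folklore] -/
theorem sliceInterior_homotopic (κ : BoundaryCollar W₂ A) {u : I} (hu : 0 < u) :
    ((⟨Subtype.val, continuous_subtype_val⟩ : C(↥κ.interior, W₂)).comp (sliceInterior κ hu)).Homotopic
      (bottom κ) := by
  refine ⟨{ toFun := fun p => κ.collar (p.2, ⟨(unitInterval.symm p.1 : ℝ) * u, mul_mem' _ u⟩)
            continuous_toFun := κ.continuous.comp (continuous_snd.prodMk (Continuous.subtype_mk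
              ((continuous_subtype_val.comp (unitInterval.continuous_symm.comp continuous_fst)).mul
                continuous_const) _))
            map_zero_left := fun a => ?_
            map_one_left := fun a => ?_ }⟩
  · show κ.collar (a, _) = κ.collar (a, u)
    congr 2; apply Subtype.ext; simp
  · show κ.collar (a, _) = κ.collar (a, 0)
    congr 2; apply Subtype.ext; simp

/-- **`Hₖ(U t ∩ V) → Hₖ(V)` is an isomorphism when the boundary inclusion `A → W₂` is a homology
isomorphism in degree `k`**: up to the homeomorphisms `U t ∩ V ≅ strip t`, `V ≅ interior` and the
homotopy equivalences `A ≃ strip t` (slice at a level `0 < u < t`), `interior ≃ W₂`, the inclusion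
`U t ∩ V ↪ V` is the slice `a ↦ κ (a, u)`, homotopic to `a ↦ κ (a, 0)`. [folklore] -/
theorem isIso_singularHomology_map_inter_V {t : I} (ht : 0 < t) (k : ℕ)
    (hbot : IsIso (singularHomology.map R M (bottom κ) k)) :
    IsIso (singularHomology.map R M
      (subsetInclusion (inter_subset_right : d.U t ∩ d.V ⊆ d.V)) k) := by
  obtain ⟨u, hu, hut⟩ := DoubleData.exists_level_between ht
  -- (1) the slice into the interior is a homology isomorphism
  have h1 : IsIso (singularHomology.map R M (sliceInterior κ hu) k) := by
    have hcomp := singularHomology.map_eq_of_homotopic R M (sliceInterior_homotopic κ hu) k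
    rw [singularHomology.map_comp] at hcomp
    have hincl : IsIso (singularHomology.map R M
        (⟨Subtype.val, continuous_subtype_val⟩ : C(↥κ.interior, W₂)) k) := by
      have : (⟨Subtype.val, continuous_subtype_val⟩ : C(↥κ.interior, W₂)) =
          (κ.interiorHomotopyEquiv ht).toFun := by
        ext p; rfl
      rw [this]
      exact (singularHomology.isoOfHomotopyEquiv R M (κ.interiorHomotopyEquiv ht) k).isIso_hom
    have hc : IsIso (singularHomology.map R M (sliceInterior κ hu) k ≫ singularHomology.map R M
        (⟨Subtype.val, continuous_subtype_val⟩ : C(↥κ.interior, W₂)) k) := by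
      rw [hcomp]; exact hbot
    exact IsIso.of_isIso_comp_right _ (singularHomology.map R M
        (⟨Subtype.val, continuous_subtype_val⟩ : C(↥κ.interior, W₂)) k)
  -- (2) the slice into `U t ∩ V` is a homology isomorphism (homotopy equivalence `A ≃ strip t`)
  let sl : C(A, ↥(d.U t ∩ d.V)) :=
    ((d.UInterVHomeomorph t : C(↥(κ.strip t), ↥(d.U t ∩ d.V))).comp
      (κ.stripHomotopyEquiv hu hut).toFun)
  have h2 : IsIso (singularHomology.map R M sl k) := by
    have : sl = ((κ.stripHomotopyEquiv hu hut).trans (d.UInterVHomeomorph t).toHomotopyEquiv).toFun := by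
      rfl
    rw [this]
    exact (singularHomology.isoOfHomotopyEquiv R M _ k).isIso_hom
  -- (3) `incl ∘ sl = VHomeomorph ∘ sliceInterior`
  have h3 : (subsetInclusion (inter_subset_right : d.U t ∩ d.V ⊆ d.V)).comp sl =
      (d.VHomeomorph : C(↥κ.interior, ↥d.V)).comp (sliceInterior κ hu) := by
    ext a
    rfl
  have h4 : IsIso (singularHomology.map R M sl k ≫ singularHomology.map R M
      (subsetInclusion (inter_subset_right : d.U t ∩ d.V ⊆ d.V)) k) := by
    rw [← singularHomology.map_comp, h3, singularHomology.map_comp]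
    haveI := h1
    haveI : IsIso (singularHomology.map R M (d.VHomeomorph : C(↥κ.interior, ↥d.V)) k) :=
      (singularHomology.mapIso R M d.VHomeomorph k).isIso_hom
    infer_instance
  haveI := h2
  exact IsIso.of_isIso_comp_left (singularHomology.map R M sl k) _

/-- `Hₖ(U t; M) = 0` for `k ≥ 1` when `W₁` is contractible. [folklore] -/
theorem isZero_singularHomology_U [ContractibleSpace W₁] {t : I} (ht : 0 < t) {k : ℕ} (hk : k ≠ 0) :
    IsZero (singularHomology R M ↥(d.U t) k) := by
  haveI := d.contractibleSpace_U ht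
  exact isZero_singularHomology_of_contractibleSpace R M hk

include d in
/-- **Homology of `W₁ ∪_A W₂` for `W₁` contractible and `A → W₂` a homology isomorphism**:
`Hₖ(P; M) = 0` for all `k ≥ 1`. Mayer–Vietoris for the open cover `U t ≃ W₁`, `V ≃ W₂`,
`U t ∩ V ≃ A` (Hatcher 2002, §2.2, p. 149): the first map
`Hⱼ(U ∩ V) → Hⱼ(U) ⊕ Hⱼ(V)` is injective in every degree (its second component is an
isomorphism), so the connecting maps vanish and `Hₖ(U) ⊕ Hₖ(V) → Hₖ(P)` is onto; it is also zero,
since `Hₖ(U) = 0` and every class of `Hₖ(V)` comes from `Hₖ(U ∩ V)`, whose image in `Hₖ(P)` equals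
its image through `Hₖ(U) = 0`. [cite: HatcherAT2002, §2.2 p. 149] -/
theorem isZero_singularHomology [ContractibleSpace W₁]
    (hbot : ∀ k, IsIso (singularHomology.map R M (bottom κ) k)) {k : ℕ} (hk : k ≠ 0) :
    IsZero (singularHomology R M P k) := by
  obtain ⟨j, rfl⟩ : ∃ j, k = j + 1 := ⟨k - 1, (Nat.succ_pred_eq_of_ne_zero hk).symm⟩
  have ht : (0 : I) < 1 := zero_lt_one
  have hexc := relativeSingularHomology.isIso_map_of_interior_union_interior_holds R M P
  have hUV := d.interior_U_union_interior_V ht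
  -- `φ` is a monomorphism in every degree
  have hφmono : ∀ i, Mono (mayerVietoris.φ R M (d.U 1) d.V i) := fun i => by
    haveI := d.isIso_singularHomology_map_inter_V R M ht i (hbot i)
    refine mono_of_mono_fac (biprod.lift_snd _ _ : mayerVietoris.φ R M (d.U 1) d.V i ≫ biprod.snd = _)
      |> fun h => ?_
    haveI : Mono (-singularHomology.map R M
        (subsetInclusion (inter_subset_right : d.U 1 ∩ d.V ⊆ d.V)) i) := by infer_instance
    exact mono_of_mono_fac (biprod.lift_snd _ _)
  -- hence `δ = 0` and `ψ` is an epimorphism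
  have hδ : mayerVietoris.δ R M (d.U 1) d.V hexc hUV j = 0 :=
    zero_of_comp_mono (mayerVietoris.φ R M (d.U 1) d.V j)
      (by haveI := hφmono j; exact mayerVietoris.δ_comp_φ R M (d.U 1) d.V hexc hUV j)
  haveI hψepi : Epi (mayerVietoris.ψ R M (d.U 1) d.V (j + 1)) :=
    (mayerVietoris.exact₂_holds R M (d.U 1) d.V hexc hUV j).epi_f hδ
  -- and `ψ = 0`
  have hU0 : singularHomology.map R M (subsetIncl (d.U 1)) (j + 1) = 0 :=
    (d.isZero_singularHomology_U R M ht j.succ_ne_zero).eq_of_src _ _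
  have hV0 : singularHomology.map R M (subsetIncl d.V) (j + 1) = 0 := by
    haveI := d.isIso_singularHomology_map_inter_V R M ht (j + 1) (hbot (j + 1))
    have hrel : singularHomology.map R M
        (subsetInclusion (inter_subset_right : d.U 1 ∩ d.V ⊆ d.V)) (j + 1) ≫
          singularHomology.map R M (subsetIncl d.V) (j + 1) =
        singularHomology.map R M
          (subsetInclusion (inter_subset_left : d.U 1 ∩ d.V ⊆ d.U 1)) (j + 1) ≫
            singularHomology.map R M (subsetIncl (d.U 1)) (j + 1) := by
      rw [← singularHomology.map_comp, ← singularHomology.map_comp]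
      rfl
    rw [hU0, comp_zero] at hrel
    rw [← Category.id_comp (singularHomology.map R M (subsetIncl d.V) (j + 1)),
      ← IsIso.inv_hom_id (singularHomology.map R M
        (subsetInclusion (inter_subset_right : d.U 1 ∩ d.V ⊆ d.V)) (j + 1)),
      Category.assoc, hrel, comp_zero]
  have hψ : mayerVietoris.ψ R M (d.U 1) d.V (j + 1) = 0 := by
    refine biprod.hom_ext' _ _ ?_ ?_
    · rw [mayerVietoris.ψ, biprod.inl_desc, comp_zero, hU0]
    · rw [mayerVietoris.ψ, biprod.inr_desc, comp_zero, hV0]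
  exact IsZero.of_epi_eq_zero (mayerVietoris.ψ R M (d.U 1) d.V (j + 1)) hψ

end Homology

/-! ### Simple connectivity -/

/-- The collar path from the bottom point `κ (a, 0)` to the point `κ (a, u)`. [folklore] -/
def collarPath (κ : BoundaryCollar W₂ A) (a : A) (u : I) : Path (κ.collar (a, 0)) (κ.collar (a, u)) where
  toFun s := κ.collar (a, ⟨(s : ℝ) * u, mul_mem' s u⟩)
  continuous_toFun := κ.continuous.comp ((Continuous.prodMk_right a).comp
    (Continuous.subtype_mk (continuous_subtype_val.mul continuous_const) _))
  source' := by
    show κ.collar (a, _) = κ.collar (a, 0)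
    congr 2; apply Subtype.ext; simp
  target' := by
    show κ.collar (a, _) = κ.collar (a, u)
    congr 2; apply Subtype.ext; simp

include d in
/-- A loop of `P` lying in `U t` (`t > 0`) is null-homotopic when `W₁` is contractible (`U t` is
then contractible). [folklore] -/
theorem homotopic_refl_of_forall_mem_U [ContractibleSpace W₁] {t : I} (ht : 0 < t) {x : P}
    (p : Path x x) (hp : ∀ s, p s ∈ d.U t) : p.Homotopic (Path.refl x) := by
  haveI := d.contractibleSpace_U ht
  have hU : IsSimplyConnected (d.U t) := (inferInstance : _root_.SimplyConnectedSpace ↥(d.U t))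
  obtain ⟨F, -⟩ := (isSimplyConnected_iff_exists_homotopy_refl_forall_mem.mp hU).2 x p hp
  exact ⟨F⟩

include d in
/-- A loop of `P` lying in the first piece is null-homotopic when `W₁` is contractible: it lies
in the contractible open set `U 1`. [folklore] -/
theorem homotopic_refl_of_forall_mem_range_j₁ [ContractibleSpace W₁] {x : P} (p : Path x x)
    (hp : ∀ s, p s ∈ range d.j₁) : p.Homotopic (Path.refl x) :=
  d.homotopic_refl_of_forall_mem_U zero_lt_one p fun s => d.range_j₁_subset_U zero_lt_one (hp s)

include d in
/-- **A loop of `P` inside the second piece, based at a collar point `j₂ (κ (a, u))`, is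
null-homotopic in `P`** provided `W₁` is contractible and every loop of `W₂` at `κ (a, 0)` is
homotopic to the image of a loop of `A`: conjugating by the collar path, the loop becomes (the
image under `j₂` of) a loop of `W₂` at `κ (a, 0)`, homotopic to `j₂ ∘ κ(ℓ, 0) = j₁ ∘ i₁ ∘ ℓ`, a
loop in the first piece, which is null-homotopic there. [cite: HatcherAT2002, §1.2 (van Kampen)] -/
theorem homotopic_refl_of_forall_mem_range_j₂ [ContractibleSpace W₁] (a : A) (u : I)
    (hπ : ∀ γ : Path (κ.collar (a, 0)) (κ.collar (a, 0)),
      ∃ ℓ : Path a a, γ.Homotopic (ℓ.map (bottom κ).continuous))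
    (p : Path (d.j₂ (κ.collar (a, u))) (d.j₂ (κ.collar (a, u))))
    (hp : ∀ s, p s ∈ range d.j₂) : p.Homotopic (Path.refl _) := by
  have hj₂ : Continuous d.j₂ := d.isClosedEmbedding_j₂.continuous
  -- lift `p` to a loop `q` of `W₂` at `κ (a, u)`
  let q : Path (κ.collar (a, u)) (κ.collar (a, u)) :=
    { toFun := fun s => d.j₂Inv (p s)
      continuous_toFun := d.continuousOn_j₂Inv.comp_continuous p.continuous hp
      source' := by simp
      target' := by simp }
  have hpq : p = q.map hj₂ := by
    ext s
    exact (d.j₂_j₂Inv (hp s)).symm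
  -- conjugate by the collar path
  let c : Path (κ.collar (a, 0)) (κ.collar (a, u)) := collarPath κ a u
  obtain ⟨ℓ, hℓ⟩ := hπ ((c.trans q).trans c.symm)
  -- `j₂ ∘ κ(ℓ, 0)` is a loop in the first piece, hence trivial
  have hℓ0 : ((ℓ.map (bottom κ).continuous).map hj₂).Homotopic (Path.refl _) := by
    refine d.homotopic_refl_of_forall_mem_range_j₁ _ fun s => ?_
    exact ⟨i₁ (ℓ s), d.j₁_seam (ℓ s)⟩
  have hconj : (((c.trans q).trans c.symm).map hj₂).Homotopic (Path.refl _) :=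
    (hℓ.map ⟨d.j₂, hj₂⟩).trans hℓ0
  -- unwind the conjugation in the fundamental groupoid
  rw [Path.map_trans, Path.map_trans, ← Path.map_symm] at hconj
  have h1 : ((Path.Homotopic.Quotient.mk (c.map hj₂)).trans
      (Path.Homotopic.Quotient.mk (q.map hj₂))).trans (Path.Homotopic.Quotient.mk (c.map hj₂)).symm =
      Path.Homotopic.Quotient.refl _ := by
    rw [← Path.Homotopic.Quotient.mk_symm, ← Path.Homotopic.Quotient.mk_trans,
      ← Path.Homotopic.Quotient.mk_trans, ← Path.Homotopic.Quotient.mk_refl]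
    exact Path.Homotopic.Quotient.eq.mpr hconj
  have h2 : Path.Homotopic.Quotient.mk (q.map hj₂) = Path.Homotopic.Quotient.refl _ := by
    have h3 : Path.Homotopic.Quotient.mk (q.map hj₂) =
        ((Path.Homotopic.Quotient.mk (c.map hj₂)).symm.trans
          (((Path.Homotopic.Quotient.mk (c.map hj₂)).trans
            (Path.Homotopic.Quotient.mk (q.map hj₂))).trans
            (Path.Homotopic.Quotient.mk (c.map hj₂)).symm)).trans
          (Path.Homotopic.Quotient.mk (c.map hj₂)) := by
      simp only [Path.Homotopic.Quotient.trans_assoc, Path.Homotopic.Quotient.symm_trans,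
        Path.Homotopic.Quotient.trans_refl]
      rw [← Path.Homotopic.Quotient.trans_assoc, Path.Homotopic.Quotient.symm_trans,
        Path.Homotopic.Quotient.refl_trans]
    rw [h3, h1, Path.Homotopic.Quotient.trans_refl, Path.Homotopic.Quotient.symm_trans]
  rw [hpq, ← Path.Homotopic.Quotient.eq, h2, Path.Homotopic.Quotient.mk_refl]

include d in
/-- **`W₁ ∪_A W₂` is simply connected** when `W₁` is contractible, `W₂` and `A` are path
connected, and `π₁(A, a) → π₁(W₂, κ (a, 0))` is onto for every `a` (in the unbundled form: every
loop of `W₂` at `κ (a, 0)` is homotopic to the image of a loop of `A`). Van Kampen for the open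
cover `U t ≃ W₁`, `V ≃ W₂` meeting in the path-connected `U t ∩ V ≃ A` (Hatcher 2002, Lemma 1.15
/ Thm. 1.20: `π₁(P)` is generated by the images of `π₁(U t) = 1` and of `π₁(V)`, and the latter
is the image of `π₁(U t ∩ V)`, which dies in `π₁(U t)`). [cite: HatcherAT2002, Lemma 1.15 and Thm. 1.20] -/
theorem simplyConnectedSpace [ContractibleSpace W₁] [PathConnectedSpace W₂] [PathConnectedSpace A]
    (hπ : ∀ (a : A) (γ : Path (κ.collar (a, 0)) (κ.collar (a, 0))),
      ∃ ℓ : Path a a, γ.Homotopic (ℓ.map (bottom κ).continuous)) :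
    SimplyConnectedSpace P := by
  have ht : (0 : I) < 1 := zero_lt_one
  obtain ⟨u, hu, hut⟩ := DoubleData.exists_level_between ht
  let a : A := Classical.arbitrary A
  set x₀ : P := d.j₂ (κ.collar (a, u)) with hx₀
  have hxU : x₀ ∈ d.U 1 := d.j₂_mem_U_iff.2 (κ.collar_mem_below_iff.2 hut)
  have hxV : x₀ ∈ d.V := by
    rw [d.V_eq]
    exact ⟨κ.collar (a, u), κ.collar_mem_interior_iff.2 hu, rfl⟩
  haveI : PathConnectedSpace P := d.pathConnectedSpace
  have hUpc : IsPathConnected (d.U 1) := by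
    haveI : PathConnectedSpace ↥(d.U 1) := pathConnectedSpace_of_homotopyEquiv (d.homotopyEquivU ht)
    exact isPathConnected_iff_pathConnectedSpace.2 this
  have hVpc : IsPathConnected d.V := d.isPathConnected_V ht
  have hmeet := d.isPathConnected_U_inter_V ht
  refine simplyConnectedSpace_of_isOpen_cover_of_null (c := fun b : Bool => cond b (d.U 1) d.V)
    (fun b => ?_) ?_ (fun b b' => ?_) (x₀ := x₀) (fun b => ?_) (fun b p hp => ?_)
  · cases b
    · exact d.isOpen_V
    · exact d.isOpen_U 1
  · rw [← d.U_union_V ht, union_eq_iUnion]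
  · cases b <;> cases b'
    · simpa using hVpc
    · simpa [inter_comm] using hmeet
    · simpa using hmeet
    · simpa using hUpc
  · cases b
    · exact hxV
    · exact hxU
  · cases b
    · refine d.homotopic_refl_of_forall_mem_range_j₂ a u (hπ a) p fun s => ?_
      have hs : p s ∈ d.V := hp s
      rw [d.V_eq] at hs
      obtain ⟨b, -, hb⟩ := hs
      exact ⟨b, hb⟩
    · exact d.homotopic_refl_of_forall_mem_U ht p hp

include d in
/-- The same, with the surjectivity of `π₁(A, a) → π₁(W₂, κ (a, 0))` phrased through Mathlib's
`FundamentalGroup.map`. [cite: HatcherAT2002, Thm. 1.20] -/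
theorem simplyConnectedSpace_of_surjective [ContractibleSpace W₁] [PathConnectedSpace W₂]
    [PathConnectedSpace A]
    (hπ : ∀ a : A, Function.Surjective (FundamentalGroup.map (bottom κ) a)) :
    SimplyConnectedSpace P :=
  d.simplyConnectedSpace fun a γ =>
    exists_homotopic_map_of_surjective_fundamentalGroupMap (bottom κ) a (hπ a) γ

end GluingData

end BoundaryCollar

end Literature.AlgebraicTopology.Homotopy

end
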